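import Summits.QuantumFields.GaugeBoot.WordSpaces
import Summits.QuantumFields.GaugeBoot.LinearShiftDerivatives
import Summits.QuantumFields.GaugeBoot.BootstrapFunctionals
import HarnessLib

/-!
# One-link shift derivations as operators on the word spaces (gauge-boot, L1 supplement)

HONEST FRAMING (cell `pub-gaugeboot`, page 1 of every file): the venture produces certified bounds
on lattice expectations at stated coupling, gauge group, dimension and torus size; NOT a mass gap,
NOT a continuum limit, NOT a string tension; NOT Yang–Mills-summit-bearing (barriers
`FixedCouplingUltralocality`, `PerturbativeInvisibility`). Matrix calculus only; no number.

## Content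

The Schwinger–Dyson rows of the bootstrap (`BootstrapFunctionals.IsSDFunctional`,
`BootstrapConvergence.IsBootstrapFeasible`) differentiate test functions along the one-link left
shifts `U ↦ U[i ↦ k_a(t) U_i]` of an exponential family `ρ(k_a t) = e^{t X_a}`. This file turns
"the derivative" into an OPERATOR:

* `HasShiftDeriv k i a f f'` (the row's hypothesis shape), uniqueness; `sderiv k i a f` — THE
  derivative (junk `0` when none exists); for polynomial observables it exists, is polynomial, and
  `sderiv` is additive, homogeneous and Leibniz (`sderiv_add/smul/mul`);
* ★ `sderiv_mem_wordSpace` — it PRESERVES every word space `wordSpace r S n` (a letter at the link `i`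
  is replaced by a combination of letters at `i`; letters elsewhere are constants), and kills the
  word spaces not involving `i` (`sderiv_eq_zero_of_not_mem`); `sderivL` — the induced linear
  endomorphism of the (finite-dimensional) word space;
* ★ `apply_update_mul_eq_of_sderiv_eq_zero` — an observable with vanishing derivative along `k_a`
  at `i` everywhere is invariant under the whole one-parameter subgroup at `i`;
* ★★ `eq_const_of_forall_sderiv_eq_zero` — for a family `k` EXHAUSTING `G` (every `g = k_a(t)`) and a
  finite set of directions spanning all `X_a`: an element of `wordSpace r S n`, `S` finite, killed by
  the derivations along these directions at every link of `S` is CONSTANT.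

References: M. Creutz, *Quarks, gluons and lattices* (1983) Ch. 11; Yu. Makeenko, *Methods of
contemporary gauge theory* (2002) §12. Folklore.
-/

noncomputable section

open Filter Topology NormedSpace
open Literature.MathematicalPhysics.QuantumFieldTheory (LatticeRep)

namespace Summit.QuantumFields.GaugeBoot

variable {ι : Type*} [DecidableEq ι] {G : Type*} [Group G] [TopologicalSpace G] {r : LatticeRep G}
  {K : Type*} (k : K → ℝ → G)

/-! ## The derivative along a one-link shift -/

/-- `f'` is the derivative of `f` along the one-link left shift `U ↦ U[i ↦ k_a(t) U_i]` at `t = 0`,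
at every configuration (the hypothesis shape of the Schwinger–Dyson rows). [shape] A parametric
definition of a proposition — NOT a fact. [folklore] -/
def HasShiftDeriv (i : ι) (a : K) (f f' : C(ι → G, ℝ)) : Prop :=
  ∀ U, HasDerivAt (fun t => f (Function.update U i (k a t * U i))) (f' U) 0

/-- **The shift derivation** `sderiv k i a f`: the derivative of `f` along `U ↦ U[i ↦ k_a(t) U_i]`
when a continuous one exists (it is then unique), junk value `0` otherwise. [folklore] -/
def sderiv (i : ι) (a : K) (f : C(ι → G, ℝ)) : C(ι → G, ℝ) :=
  open Classical in if h : ∃ f', HasShiftDeriv k i a f f' then h.choose else 0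

variable {k}

/-- Derivatives along a shift are unique. -/
theorem HasShiftDeriv.unique {i : ι} {a : K} {f f₁ f₂ : C(ι → G, ℝ)} (h₁ : HasShiftDeriv k i a f f₁)
    (h₂ : HasShiftDeriv k i a f f₂) : f₁ = f₂ :=
  ContinuousMap.ext fun U => (h₁ U).unique (h₂ U)

/-- `sderiv` is a derivative whenever one exists. -/
theorem hasShiftDeriv_sderiv {i : ι} {a : K} {f : C(ι → G, ℝ)} (h : ∃ f', HasShiftDeriv k i a f f') :
    HasShiftDeriv k i a f (sderiv k i a f) := by
  classical
  rw [sderiv, dif_pos h]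
  exact h.choose_spec

/-- `sderiv` is THE derivative. -/
theorem HasShiftDeriv.sderiv_eq {i : ι} {a : K} {f f' : C(ι → G, ℝ)} (h : HasShiftDeriv k i a f f') :
    sderiv k i a f = f' :=
  (hasShiftDeriv_sderiv ⟨f', h⟩).unique h

/-- Sums. -/
theorem HasShiftDeriv.add {i : ι} {a : K} {f f' g g' : C(ι → G, ℝ)} (hf : HasShiftDeriv k i a f f')
    (hg : HasShiftDeriv k i a g g') : HasShiftDeriv k i a (f + g) (f' + g') := fun U => by
  have h : HasDerivAt (fun t => f (Function.update U i (k a t * U i)) +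
      g (Function.update U i (k a t * U i))) (f' U + g' U) 0 := (hf U).add (hg U)
  simpa only [ContinuousMap.add_apply] using h

/-- Scalar multiples. -/
theorem HasShiftDeriv.smul {i : ι} {a : K} {f f' : C(ι → G, ℝ)} (hf : HasShiftDeriv k i a f f')
    (c : ℝ) : HasShiftDeriv k i a (c • f) (c • f') := fun U => by
  have h : HasDerivAt (fun t => c * f (Function.update U i (k a t * U i))) (c * f' U) 0 :=
    (hf U).const_mul c
  simpa only [ContinuousMap.smul_apply, smul_eq_mul] using h

/-- Constants. -/
theorem hasShiftDeriv_const (i : ι) (a : K) (c : ℝ) :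
    HasShiftDeriv k i a (algebraMap ℝ C(ι → G, ℝ) c) 0 := fun U => by
  simpa [Algebra.algebraMap_eq_smul_one] using hasDerivAt_const (0 : ℝ) c

variable {X : K → Matrix (Fin r.N) (Fin r.N) ℂ}

/-- Along an exponential family `k_a(0) = 1`. -/
theorem fam_zero (hX : ∀ a t, r.ρ (k a t) = exp ((t : ℂ) • X a)) (a : K) : k a 0 = 1 :=
  oneParam_zero (hX a)

/-- Leibniz. -/
theorem HasShiftDeriv.mul [ContinuousMul G] (hX : ∀ a t, r.ρ (k a t) = exp ((t : ℂ) • X a))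
    {i : ι} {a : K} {f f' g g' : C(ι → G, ℝ)} (hf : HasShiftDeriv k i a f f')
    (hg : HasShiftDeriv k i a g g') : HasShiftDeriv k i a (f * g) (f' * g + f * g') := fun U => by
  have h : HasDerivAt (fun t => f (Function.update U i (k a t * U i)) *
      g (Function.update U i (k a t * U i)))
      (f' U * g (Function.update U i (k a 0 * U i)) + f (Function.update U i (k a 0 * U i)) * g' U) 0 :=
    (hf U).mul (hg U)
  simp only [fam_zero hX, one_mul, Function.update_eq_self] at h
  simpa only [ContinuousMap.mul_apply, ContinuousMap.add_apply] using h

/-- ★ **Polynomial observables have (polynomial) shift derivatives.** -/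
theorem exists_hasShiftDeriv_of_mem_polyAlgebra [ContinuousMul G]
    (hk : ∀ a s t, k a (s + t) = k a s * k a t) (hX : ∀ a t, r.ρ (k a t) = exp ((t : ℂ) • X a))
    (i : ι) (a : K) {f : C(ι → G, ℝ)} (hf : f ∈ polyAlgebra (ι := ι) r) :
    ∃ f' ∈ polyAlgebra (ι := ι) r, HasShiftDeriv k i a f f' :=
  exists_deriv_mem_polyAlgebra r (hk a) (hX a) i hf

/-- For a polynomial observable `sderiv` is its derivative. -/
theorem hasShiftDeriv_sderiv_of_mem_polyAlgebra [ContinuousMul G]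
    (hk : ∀ a s t, k a (s + t) = k a s * k a t) (hX : ∀ a t, r.ρ (k a t) = exp ((t : ℂ) • X a))
    (i : ι) (a : K) {f : C(ι → G, ℝ)} (hf : f ∈ polyAlgebra (ι := ι) r) :
    HasShiftDeriv k i a f (sderiv k i a f) := by
  obtain ⟨f', -, hf'⟩ := exists_hasShiftDeriv_of_mem_polyAlgebra hk hX i a hf
  exact hasShiftDeriv_sderiv ⟨f', hf'⟩

/-- The derivative of a polynomial observable is polynomial. -/
theorem sderiv_mem_polyAlgebra [ContinuousMul G]
    (hk : ∀ a s t, k a (s + t) = k a s * k a t) (hX : ∀ a t, r.ρ (k a t) = exp ((t : ℂ) • X a))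
    (i : ι) (a : K) {f : C(ι → G, ℝ)} (hf : f ∈ polyAlgebra (ι := ι) r) :
    sderiv k i a f ∈ polyAlgebra (ι := ι) r := by
  obtain ⟨f', hf'm, hf'⟩ := exists_hasShiftDeriv_of_mem_polyAlgebra hk hX i a hf
  rwa [hf'.sderiv_eq]

/-- `sderiv` is additive on polynomial observables. -/
theorem sderiv_add [ContinuousMul G]
    (hk : ∀ a s t, k a (s + t) = k a s * k a t) (hX : ∀ a t, r.ρ (k a t) = exp ((t : ℂ) • X a))
    (i : ι) (a : K) {f g : C(ι → G, ℝ)} (hf : f ∈ polyAlgebra (ι := ι) r)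
    (hg : g ∈ polyAlgebra (ι := ι) r) : sderiv k i a (f + g) = sderiv k i a f + sderiv k i a g :=
  ((hasShiftDeriv_sderiv_of_mem_polyAlgebra hk hX i a hf).add
    (hasShiftDeriv_sderiv_of_mem_polyAlgebra hk hX i a hg)).sderiv_eq

/-- `sderiv` is homogeneous on polynomial observables. -/
theorem sderiv_smul [ContinuousMul G]
    (hk : ∀ a s t, k a (s + t) = k a s * k a t) (hX : ∀ a t, r.ρ (k a t) = exp ((t : ℂ) • X a))
    (i : ι) (a : K) (c : ℝ) {f : C(ι → G, ℝ)} (hf : f ∈ polyAlgebra (ι := ι) r) :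
    sderiv k i a (c • f) = c • sderiv k i a f :=
  ((hasShiftDeriv_sderiv_of_mem_polyAlgebra hk hX i a hf).smul c).sderiv_eq

/-- ★ **Leibniz rule** for `sderiv` on polynomial observables. -/
theorem sderiv_mul [ContinuousMul G]
    (hk : ∀ a s t, k a (s + t) = k a s * k a t) (hX : ∀ a t, r.ρ (k a t) = exp ((t : ℂ) • X a))
    (i : ι) (a : K) {f g : C(ι → G, ℝ)} (hf : f ∈ polyAlgebra (ι := ι) r)
    (hg : g ∈ polyAlgebra (ι := ι) r) :
    sderiv k i a (f * g) = sderiv k i a f * g + f * sderiv k i a g :=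
  ((hasShiftDeriv_sderiv_of_mem_polyAlgebra hk hX i a hf).mul hX
    (hasShiftDeriv_sderiv_of_mem_polyAlgebra hk hX i a hg)).sderiv_eq

omit [DecidableEq ι] in
/-- `sderiv` of a constant vanishes. -/
theorem sderiv_algebraMap [DecidableEq ι] (i : ι) (a : K) (c : ℝ) :
    sderiv k i a (algebraMap ℝ C(ι → G, ℝ) c) = 0 :=
  (hasShiftDeriv_const i a c).sderiv_eq

/-- `sderiv 1 = 0`. -/
theorem sderiv_one (i : ι) (a : K) : sderiv k i a (1 : C(ι → G, ℝ)) = 0 := by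
  simpa using sderiv_algebraMap (k := k) i a 1

/-- `sderiv 0 = 0`. -/
theorem sderiv_zero (i : ι) (a : K) : sderiv k i a (0 : C(ι → G, ℝ)) = 0 :=
  HasShiftDeriv.sderiv_eq fun U => by simpa using hasDerivAt_const (0 : ℝ) (0 : ℝ)

/-! ## Generators and words -/

/-- The derivative of `Re ρ(U_i)_{bc}` along `k_a` at `i` is `Re (X_a ρ(U_i))_{bc}`; at another link it
is `0`. -/
theorem hasShiftDeriv_reEntry (hX : ∀ a t, r.ρ (k a t) = exp ((t : ℂ) • X a)) (i j : ι) (a : K)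
    (b c : Fin r.N) : HasShiftDeriv k i a (reEntry r j b c)
      (if j = i then reEntryShiftDeriv r (X a) j b c else 0) := fun U => by
  have h := hasDerivAt_entry_re (hasDerivAt_rho_update r.ρ (hX a) i j U) b c
  by_cases hji : j = i
  · rw [if_pos hji]
    rw [if_pos hji] at h
    subst hji
    simpa only [reEntryShiftDeriv_apply, reEntry_apply] using h
  · rw [if_neg hji]
    rw [if_neg hji] at h
    simpa only [reEntry_apply, Matrix.zero_apply, Complex.zero_re, ContinuousMap.zero_apply] using h

/-- The derivative of `Im ρ(U_i)_{bc}`. -/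
theorem hasShiftDeriv_imEntry (hX : ∀ a t, r.ρ (k a t) = exp ((t : ℂ) • X a)) (i j : ι) (a : K)
    (b c : Fin r.N) : HasShiftDeriv k i a (imEntry r j b c)
      (if j = i then imEntryShiftDeriv r (X a) j b c else 0) := fun U => by
  have h := hasDerivAt_entry_im (hasDerivAt_rho_update r.ρ (hX a) i j U) b c
  by_cases hji : j = i
  · rw [if_pos hji]
    rw [if_pos hji] at h
    subst hji
    simpa only [imEntryShiftDeriv_apply, imEntry_apply] using h
  · rw [if_neg hji]
    rw [if_neg hji] at h
    simpa only [imEntry_apply, Matrix.zero_apply, Complex.zero_im, ContinuousMap.zero_apply] using h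

/-- The derivative of a generator at `S` lies in the degree-`1` word space at `S`, and vanishes if
the generator's link is not the shifted one. -/
theorem sderiv_entryGen_mem (hX : ∀ a t, r.ρ (k a t) = exp ((t : ℂ) • X a)) {S : Set ι} (i : ι)
    (a : K) {x : C(ι → G, ℝ)} (hx : x ∈ entryGensOn r S) :
    sderiv k i a x ∈ wordSpace r S 1 ∧ (i ∉ S → sderiv k i a x = 0) := by
  obtain ⟨j, hj, b, c, rfl | rfl⟩ := exists_of_mem_entryGensOn hx
  · rw [(hasShiftDeriv_reEntry hX i j a b c).sderiv_eq]
    by_cases hji : j = i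
    · subst hji
      refine ⟨?_, fun hi => (hi hj).elim⟩
      rw [if_pos rfl, reEntryShiftDeriv]
      exact Submodule.sum_mem _ fun c' _ => Submodule.sub_mem _
        (Submodule.smul_mem _ _ (mem_wordSpace_of_mem_entryGensOn r (reEntry_mem_entryGensOn hj c' c) le_rfl))
        (Submodule.smul_mem _ _ (mem_wordSpace_of_mem_entryGensOn r (imEntry_mem_entryGensOn hj c' c) le_rfl))
    · rw [if_neg hji]
      exact ⟨Submodule.zero_mem _, fun _ => rfl⟩
  · rw [(hasShiftDeriv_imEntry hX i j a b c).sderiv_eq]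
    by_cases hji : j = i
    · subst hji
      refine ⟨?_, fun hi => (hi hj).elim⟩
      rw [if_pos rfl, imEntryShiftDeriv]
      exact Submodule.sum_mem _ fun c' _ => Submodule.add_mem _
        (Submodule.smul_mem _ _ (mem_wordSpace_of_mem_entryGensOn r (imEntry_mem_entryGensOn hj c' c) le_rfl))
        (Submodule.smul_mem _ _ (mem_wordSpace_of_mem_entryGensOn r (reEntry_mem_entryGensOn hj c' c) le_rfl))
    · rw [if_neg hji]
      exact ⟨Submodule.zero_mem _, fun _ => rfl⟩

/-- The derivative of a word at `S` of length `≤ n` lies in `wordSpace r S n`, and vanishes if `i ∉ S`. -/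
theorem sderiv_prod_mem [ContinuousMul G]
    (hk : ∀ a s t, k a (s + t) = k a s * k a t) (hX : ∀ a t, r.ρ (k a t) = exp ((t : ℂ) • X a))
    {S : Set ι} (i : ι) (a : K) (l : List C(ι → G, ℝ)) (hl : ∀ x ∈ l, x ∈ entryGensOn r S) {n : ℕ}
    (hlen : l.length ≤ n) :
    sderiv k i a l.prod ∈ wordSpace r S n ∧ (i ∉ S → sderiv k i a l.prod = 0) := by
  induction l generalizing n with
  | nil =>
    rw [List.prod_nil, sderiv_one]
    exact ⟨Submodule.zero_mem _, fun _ => rfl⟩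
  | cons x l ih =>
    have hx : x ∈ entryGensOn r S := hl x List.mem_cons_self
    have hl' : ∀ y ∈ l, y ∈ entryGensOn r S := fun y hy => hl y (List.mem_cons_of_mem x hy)
    obtain ⟨m, rfl⟩ : ∃ m, n = m + 1 := ⟨n - 1, by simp at hlen; omega⟩
    have hlen' : l.length ≤ m := by simpa using hlen
    have hxA : x ∈ polyAlgebra (ι := ι) r := Algebra.subset_adjoin (entryGensOn_subset_entryGens r S hx)
    have hlA : l.prod ∈ polyAlgebra (ι := ι) r :=
      mem_polyAlgebra_of_mem_wordSpace r (subset_wordSpace r S m ⟨l, hl', hlen', rfl⟩)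
    obtain ⟨ih1, ih2⟩ := ih hl' hlen'
    obtain ⟨hx1, hx2⟩ := sderiv_entryGen_mem hX i a hx
    rw [List.prod_cons, sderiv_mul hk hX i a hxA hlA]
    refine ⟨?_, fun hi => by rw [hx2 hi, ih2 hi, zero_mul, mul_zero, add_zero]⟩
    have h1 : sderiv k i a x * l.prod ∈ wordSpace r S (1 + m) :=
      mul_mem_wordSpace r hx1 (subset_wordSpace r S m ⟨l, hl', hlen', rfl⟩)
    have h2 : x * sderiv k i a l.prod ∈ wordSpace r S (1 + m) :=
      mul_mem_wordSpace r (mem_wordSpace_of_mem_entryGensOn r hx le_rfl) ih1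
    rw [add_comm] at h1 h2
    exact Submodule.add_mem _ h1 h2

/-- ★ **The shift derivations preserve the word spaces** (and kill those not involving the shifted
link). [folklore] -/
theorem sderiv_mem_wordSpace [ContinuousMul G]
    (hk : ∀ a s t, k a (s + t) = k a s * k a t) (hX : ∀ a t, r.ρ (k a t) = exp ((t : ℂ) • X a))
    {S : Set ι} {n : ℕ} (i : ι) (a : K) {f : C(ι → G, ℝ)} (hf : f ∈ wordSpace r S n) :
    sderiv k i a f ∈ wordSpace r S n := by
  induction hf using Submodule.span_induction with
  | mem w hw =>
    obtain ⟨l, hl, hlen, rfl⟩ := hw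
    exact (sderiv_prod_mem hk hX i a l hl hlen).1
  | zero => rw [sderiv_zero]; exact Submodule.zero_mem _
  | add f g hf hg ihf ihg =>
    rw [sderiv_add hk hX i a (mem_polyAlgebra_of_mem_wordSpace r hf)
      (mem_polyAlgebra_of_mem_wordSpace r hg)]
    exact Submodule.add_mem _ ihf ihg
  | smul c f hf ihf =>
    rw [sderiv_smul hk hX i a c (mem_polyAlgebra_of_mem_wordSpace r hf)]
    exact Submodule.smul_mem _ c ihf

/-- The shift derivation at a link outside `S` kills `wordSpace r S n`. -/
theorem sderiv_eq_zero_of_not_mem [ContinuousMul G]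
    (hk : ∀ a s t, k a (s + t) = k a s * k a t) (hX : ∀ a t, r.ρ (k a t) = exp ((t : ℂ) • X a))
    {S : Set ι} {n : ℕ} {i : ι} (hi : i ∉ S) (a : K) {f : C(ι → G, ℝ)} (hf : f ∈ wordSpace r S n) :
    sderiv k i a f = 0 := by
  induction hf using Submodule.span_induction with
  | mem w hw =>
    obtain ⟨l, hl, hlen, rfl⟩ := hw
    exact (sderiv_prod_mem hk hX i a l hl hlen).2 hi
  | zero => rw [sderiv_zero]
  | add f g hf hg ihf ihg =>
    rw [sderiv_add hk hX i a (mem_polyAlgebra_of_mem_wordSpace r hf)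
      (mem_polyAlgebra_of_mem_wordSpace r hg), ihf, ihg, add_zero]
  | smul c f hf ihf =>
    rw [sderiv_smul hk hX i a c (mem_polyAlgebra_of_mem_wordSpace r hf), ihf, smul_zero]

/-- ★ **The shift derivation as a linear endomorphism of the word space.** [folklore] -/
def sderivL [ContinuousMul G]
    (hk : ∀ a s t, k a (s + t) = k a s * k a t) (hX : ∀ a t, r.ρ (k a t) = exp ((t : ℂ) • X a))
    (S : Set ι) (n : ℕ) (i : ι) (a : K) : wordSpace r S n →ₗ[ℝ] wordSpace r S n where
  toFun f := ⟨sderiv k i a f, sderiv_mem_wordSpace hk hX i a f.2⟩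
  map_add' f g := Subtype.ext (sderiv_add hk hX i a (mem_polyAlgebra_of_mem_wordSpace r f.2)
    (mem_polyAlgebra_of_mem_wordSpace r g.2))
  map_smul' c f := Subtype.ext (sderiv_smul hk hX i a c (mem_polyAlgebra_of_mem_wordSpace r f.2))

/-- `sderivL` is `sderiv`. -/
@[simp] theorem coe_sderivL [ContinuousMul G]
    (hk : ∀ a s t, k a (s + t) = k a s * k a t) (hX : ∀ a t, r.ρ (k a t) = exp ((t : ℂ) • X a))
    (S : Set ι) (n : ℕ) (i : ι) (a : K) (f : wordSpace r S n) :
    ((sderivL hk hX S n i a f : wordSpace r S n) : C(ι → G, ℝ)) = sderiv k i a f := rfl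

/-! ## Vanishing derivatives: invariance and constancy -/

/-- ★ **Zero derivative everywhere ⇒ invariance under the one-parameter subgroup.** If `f` has shift
derivative `0` along `k_a` at `i` (at every configuration), then `f(U[i ↦ k_a(t) U_i]) = f(U)`.
[folklore] -/
theorem apply_update_mul_eq_of_hasShiftDeriv_zero
    (hk : ∀ a s t, k a (s + t) = k a s * k a t) (hX : ∀ a t, r.ρ (k a t) = exp ((t : ℂ) • X a))
    {i : ι} {a : K} {f : C(ι → G, ℝ)} (hf : HasShiftDeriv k i a f 0) (U : ι → G) (t : ℝ) :
    f (Function.update U i (k a t * U i)) = f U := by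
  set g : ℝ → ℝ := fun s => f (Function.update U i (k a s * U i)) with hg
  have hderiv : ∀ s, HasDerivAt g 0 s := fun s => by
    have h0 := hf (Function.update U i (k a s * U i))
    simp only [Function.update_idem, Function.update_self, ContinuousMap.zero_apply] at h0
    have h1 : HasDerivAt (fun t => g (t + s)) 0 0 := by
      refine h0.congr_of_eventuallyEq (Eventually.of_forall fun t => ?_)
      simp only [hg, ← mul_assoc, ← hk a t s]
    have h2 := HasDerivAt.comp_sub_const s s (by rwa [sub_self] : HasDerivAt (fun t => g (t + s)) 0 (s - s))
    simpa only [sub_add_cancel] using h2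
  have hconst := is_const_of_deriv_eq_zero (fun s => (hderiv s).differentiableAt)
    (fun s => (hderiv s).deriv) t 0
  simpa only [hg, fam_zero hX, one_mul, Function.update_eq_self] using hconst

/-- ★★ **Killed by all derivations at the links of `S` ⇒ constant.** Let the family `k` exhaust `G`
(every element lies on one of the one-parameter subgroups) and let the directions `X (gen m)`,
`m : Fin M`, span all the `X a`. If `f ∈ wordSpace r S n`, `S` finite, has `sderiv k i (gen m) f = 0`
for all `i ∈ S` and all `m`, then `f` is the constant `f(1)`. [folklore] -/
theorem eq_const_of_forall_sderiv_eq_zero [ContinuousMul G]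
    (hk : ∀ a s t, k a (s + t) = k a s * k a t) (hX : ∀ a t, r.ρ (k a t) = exp ((t : ℂ) • X a))
    (hexh : ∀ g : G, ∃ a t, k a t = g) {M : ℕ} (gen : Fin M → K)
    (hspan : ∀ a, X a ∈ Submodule.span ℝ (Set.range fun m => X (gen m)))
    {S : Set ι} (hS : S.Finite) {n : ℕ} {f : C(ι → G, ℝ)} (hf : f ∈ wordSpace r S n)
    (h0 : ∀ i ∈ S, ∀ m, sderiv k i (gen m) f = 0) :
    f = algebraMap ℝ C(ι → G, ℝ) (f 1) := by
  have hfA : f ∈ polyAlgebra (ι := ι) r := mem_polyAlgebra_of_mem_wordSpace r hf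
  -- every direction kills `f` at the links of `S` (linearity of the derivative in the generator)
  have hall : ∀ i ∈ S, ∀ a, HasShiftDeriv k i a f 0 := fun i hi a => by
    obtain ⟨D, hD⟩ := exists_hasLinearShiftDeriv_of_mem_polyAlgebra r i hfA
    have hDa : ∀ a U, sderiv k i a f U = D U (X a) := fun a U =>
      hD.eq_of_hasDerivAt (hX a) (hasShiftDeriv_sderiv_of_mem_polyAlgebra hk hX i a hfA U)
    have hker : ∀ U, Submodule.span ℝ (Set.range fun m => X (gen m)) ≤ LinearMap.ker (D U) :=
      fun U => Submodule.span_le.2 (by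
        rintro _ ⟨m, rfl⟩
        rw [SetLike.mem_coe, LinearMap.mem_ker, ← hDa (gen m) U, h0 i hi m, ContinuousMap.zero_apply])
    have hzero : ∀ U, D U (X a) = 0 := fun U => LinearMap.mem_ker.1 (hker U (hspan a))
    intro U
    have h := hasShiftDeriv_sderiv_of_mem_polyAlgebra hk hX i a hfA U
    rwa [hDa a U, hzero U] at h
  -- hence invariance under every one-link shift at the links of `S`
  have hinv : ∀ i ∈ S, ∀ (g : G) (U : ι → G), f (Function.update U i (g * U i)) = f U :=
    fun i hi g U => by
    obtain ⟨a, t, rfl⟩ := hexh g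
    exact apply_update_mul_eq_of_hasShiftDeriv_zero hk hX (hall i hi a) U t
  have hone : ∀ i ∈ S, ∀ U : ι → G, f (Function.update U i 1) = f U := fun i hi U => by
    simpa only [inv_mul_cancel] using hinv i hi (U i)⁻¹ U
  -- set the links of `S` to `1` one at a time, then use locality
  have key : ∀ T : Finset ι, (∀ i ∈ T, i ∈ S) →
      ∀ U : ι → G, f U = f (fun j => if j ∈ T then 1 else U j) := by
    intro T
    induction T using Finset.induction_on with
    | empty => intro _ U; simp
    | insert i T hiT ih =>
      intro hT U
      rw [ih (fun j hj => hT j (Finset.mem_insert_of_mem hj)),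
        ← hone i (hT i (Finset.mem_insert_self i T))]
      congr 1
      funext j
      by_cases hj : j = i
      · subst hj
        simp
      · simp [hj]
  ext U
  rw [key hS.toFinset (fun i hi => hS.mem_toFinset.1 hi) U]
  simp only [Algebra.algebraMap_eq_smul_one, ContinuousMap.smul_apply, ContinuousMap.one_apply,
    smul_eq_mul, mul_one]
  exact apply_eq_of_mem_wordSpace r hf fun i hi => by simp [hS.mem_toFinset.2 hi]

end Summit.QuantumFields.GaugeBoot

end
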